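import Literature.MathematicalPhysics.QuantumFieldTheory.MagnenRivasseauSeneor1993.MRS93PhaseCells
import Literature.MathematicalPhysics.QuantumFieldTheory.MagnenRivasseauSeneor1993.MRS93ConvergencePowerCounting
import HarnessLib

/-!
# Magnen–Rivasseau–Sénéor, *Construction of YM₄ with an infrared cutoff* (CMP 155, 1993): the anisotropic lattices `𝐃_{i,α}`
# REFINE EACH OTHER — «It is convenient to take M an integer and these boxes as refinements of a fixed lattice at the unit scale»
# (§II.B p.335 tl.18–19) — and the two BOX COUNTS of the vertical resummations of Sect. VII, «the box of scale α′ (which contains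
# M^{α−α′} boxes of scale α)» (p.375 tl.22–23) and «the M^{4|i−i′|} boxes of scale i contained in a box of scale i′» (p.375 tl.35–36),
# PROVED for the tree's boxes `PhaseCells.anisoBox` and joined to the exponent arithmetic of `…MRS93ConvergencePowerCounting`

elementary geometry of half-open lattice cells and finite counting (`Fintype.piFinset`, `Int.card_Ico`); nothing here is a claim
about the Yang–Mills mass gap, about continuum YM₄ on `T⁴` (with or without infrared cutoff), or about the Clay problem — and nothing
of the vertical ∕ horizontal ∕ Mayer expansions of Sect. VII (a SKETCH in print), whose convergence these counts serve, is asserted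

**Citation header (reproduction of PUBLISHED work).** J. Magnen, V. Rivasseau, R. Sénéor, *Construction of YM₄ with an infrared
cutoff*, Commun. Math. Phys. **155** (1993) 325–383 [MagnenRivasseauSeneor1993]: §II.B p.335 tl.16–19 (the lattices `𝐃_{i,α}`),
Sect. VII p.375 tl.21–25 and tl.33–36 (the vertical resummations). Loci «p.NNN [PDF nn] tl.k» = journal page, PDF page (= journal
page − 324), text-layer line of the held scan `paper:magnen1993-cmp155-mrs-ym4-infrared-cutoff`. Cell pub-balaban-gaps (YM blitz,
track G3), seat mrs-lit-2 (gen 17, file 46; v1 landed as p392499, EDITION v1.1 = §5–§6 appended, add-only); companion record `run/shared/lean/pub/pub-balaban-gaps/g3/MRS-AS-PRINTED-estimates.md`.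
Siblings whose vocabulary is USED, not re-typed: `…MRS93PhaseCells` (mrs-lit-1: `PhaseCells.anisoBox M i α k` = the box of `𝐃_{i,α}`
with lower corner `k ∈ ℤ⁴` in units of the sides `PhaseCells.boxSide`, `M^{−α}` in the direction 0 and `M^{−i}` in the directions
1, 2, 3), `…MRS93ConvergencePowerCounting` (this seat, file 4: `Convergence.resum_alpha`, `Convergence.resum_vertical`,
`Convergence.vertical_sum_converges` — the printed exponent arithmetic, which took the two counts as numbers; here the counts are
theorems about the boxes).

**What the paper prints (verbatim).**
* p.335 [PDF 11] tl.16–19: *«We introduce also anisotropic lattices 𝐃_{i,α} for (i, α) ∈ 𝐏. The union of these lattices is called 𝐃.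
  𝐃_{i,α} is the lattice of boxes of side M^{−i} in the directions 1, 2, 3 and of side M^{−α} in the direction 0. It is convenient to
  take M an integer and these boxes as refinements of a fixed lattice at the unit scale.»*
* p.375 [PDF 51] tl.21–25: *«we conclude that in the vertical expansion any contribution of scale α attached to a box of scale α′,
  with α_min ≤ α′ < α can be resummed in the box of scale α′ (which contains M^{α−α′} boxes of scale α) using one coupling constant
  λ ≤ M^{−(α−α′)}; furthermore there remains a small factor of size at least λ. Finally there remains a factor at least M^{−(i−α)}
  which means that the sum over α can be performed»*.
* p.375 tl.44–47: *«which are the "proximity" links, both in the vertical and horizontal directions between large field boxes (and the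
  associated "protection corridors" introduced previously). All these links extend only to a bounded distance, independent of λ. It is
  possible to resum over such links (which costs only a factor independent of λ)»*; p.376 [PDF 52] tl.29–31: *«Indeed there are M⁴ boxes
  of the next higher frequency in a typical cubic box … But there is only one box which contains a box in the next lower frequency.»*
* p.375 tl.33–36: *«in the case of five or more legs (t_Δ ≠ 0) power counting provides the necessary factor M^{−5|i−i′|} to resum a
  box of scale i among the M^{4|i−i′|} boxes of scale i contained in a box of scale i′.»*

**What is formalised (every statement below is a `theorem` with its proof; `M` a natural number, cast to `ℝ` in `anisoBox`).**
* §1 ONE DIMENSION: `Ico_subset_Ico_iff_labels` — for meshes `s = n·t` the fine cell `[a t, (a+1) t)` lies in the coarse cell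
  `[a′ s, (a′+1) s)` iff `a′n ≤ a < (a′+1)n`; `card_Ico_labels` — there are `n` such `a`.
* §2 NESTING AND COUNTING: `ratio M i i′ α α′ μ` (`M^{α−α′}` for `μ = 0`, `M^{i−i′}` otherwise) with `boxSide_coarse_eq`
  (`side′_μ = ratio_μ · side_μ` for `i′ ≤ i`, `α′ ≤ α`); `anisoBox_subset_iff` — `Δ_k ⊆ Δ′_{k′}` iff `k′_μ r_μ ≤ k_μ < (k′_μ+1) r_μ`
  for all `μ`; `fineLabels M i i′ α α′ k′` (the labels of the boxes of `𝐃_{i,α}` inside `Δ′_{k′} ∈ 𝐃_{i′,α′}`, `mem_fineLabels_iff`);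
  **`card_fineLabels`** `= M^{α−α′}·M^{3(i−i′)}`, with the two printed special cases **`card_fineLabels_time`** (`i′ = i`:
  `M^{α−α′}`, p.375 tl.22–23) and **`card_fineLabels_isotropic`** (`α = i`, `α′ = i′`: `M^{4(i−i′)}`, p.375 tl.35–36).
* §3 REFINEMENT: `exists_fine_box` (every point of `Δ′_{k′}` lies in the box of `𝐃_{i,α}` labelled by the integer parts
  `⌊x_μ/side_μ⌋`, which is one of the `fineLabels`), **`biUnion_fine_boxes_eq`** (`Δ′_{k′} = ⋃_{k ∈ fineLabels} Δ_k`),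
  `disjoint_anisoBox` (distinct boxes of one lattice are disjoint — half-open cells).
* §4 THE TWO RESUMMATION COUNTS IN USE: `sum_coupling_fineLabels_le_one` — `Σ_{Δ ⊆ Δ′, Δ ∈ 𝐃_{i,α}} λ ≤ 1` whenever
  `λ ≤ M^{−(α−α′)}` (count × `Convergence.resum_alpha`); `sum_powerCounting_fineLabels_eq` —
  `Σ_{Δ ⊆ Δ′, Δ ∈ 𝐃_{i,i}} M^{−5|i−i′|} = M^{−|i−i′|}` for `Δ′ ∈ 𝐃_{i′,i′}`, `i′ ≤ i` (count × `Convergence.resum_vertical`), the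
  summand of `Convergence.vertical_sum_converges`.

* §5 (EDITION v1.1) UPWARD UNIQUENESS: `existsUnique_coarse_box` — every box of `𝐃_{i,α}` lies in exactly one box of `𝐃_{i′,α′}`
  (`i′ ≤ i`, `α′ ≤ α`; «there is only one box which contains a box in the next lower frequency», p.376 tl.31); `card_fineLabels_next` —
  «there are M⁴ boxes of the next higher frequency in a typical cubic box» (p.376 tl.29–30).
* §6 (EDITION v1.1) PROXIMITY LINKS (p.375 tl.44–47 «All these links extend only to a bounded distance, independent of λ … which costs only
  a factor independent of λ»): `proximityLabels k L` (labels within sup-distance `L`), `mem_proximityLabels_iff`, **`card_proximityLabels`**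
  `= (2L+1)⁴`, `sum_proximityLabels_le`.

**Reading conventions.** (i) «scale α» at fixed `i` = the lattice `𝐃_{i,α}`; «a box of scale i» in tl.35–36 = a box of the
isotropic lattice `𝐃_{i,i}` (side `M^{−i}` in all four directions; the count `M^{4|i−i′|}` is the one printed); for a general pair of
lattices the count is `card_fineLabels`. (ii) `α, α′ ∈ ℤ` in §2–§3 as in `PhaseCells.anisoBox` (the print allows `N_i < 0`); `ℕ` in
the two printed special cases and in §4, as in `…MRS93ConvergencePowerCounting`. (iii) Nesting is stated for `i′ ≤ i` and `α′ ≤ α`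
(finer in every direction); boxes of two lattices with crossed indices need not nest and are not treated.

**What is NOT claimed.** The vertical, horizontal and Mayer expansions of Sect. VII, their links and their convergence («The
structure of these sums is basically similar to the case considered in [R]», p.375 tl.3–5), the power counting of the vertices
(file 4 types it), or anything about the functional integrals. Nothing here bears on Bałaban's papers.
-/

noncomputable section

open Set

namespace Literature.MathematicalPhysics.QuantumFieldTheory.MagnenRivasseauSeneor1993

namespace NestedLattices

open PhaseCells (anisoBox boxSide boxSide_pos)

/-! ## §1 One dimension: a cell of mesh `t` inside a cell of mesh `s = n·t` -/

/-- **Nested cells in one dimension.** For meshes `s = n·t` (`n ≥ 1` an integer, `t > 0`), the fine cell `[a t, (a+1) t)` lies in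
the coarse cell `[a′ s, (a′+1) s)` iff `a′ n ≤ a < (a′+1) n` (`n` a natural number; for `n = 0` both sides are false) — «It is convenient to take M an integer and these boxes as refinements
of a fixed lattice at the unit scale» (p.335 tl.18–19), one direction at a time. [cite: MagnenRivasseauSeneor1993, §II.B p.335 tl.16–19] -/
theorem Ico_subset_Ico_iff_labels {t : ℝ} (ht : 0 < t) (n : ℕ) (a a' : ℤ) :
    Ico ((a : ℝ) * t) (((a : ℝ) + 1) * t) ⊆ Ico ((a' : ℝ) * (n * t)) (((a' : ℝ) + 1) * (n * t))
      ↔ a' * n ≤ a ∧ a < (a' + 1) * n := by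
  have hne : (a : ℝ) * t < ((a : ℝ) + 1) * t := by nlinarith
  rw [Ico_subset_Ico_iff hne]
  constructor
  · rintro ⟨h1, h2⟩
    have h1' : ((a' : ℝ)) * n ≤ a := by
      by_contra h; rw [not_le] at h; nlinarith
    have h2' : (a : ℝ) + 1 ≤ ((a' : ℝ) + 1) * n := by
      by_contra h; rw [not_le] at h; nlinarith
    constructor
    · exact_mod_cast h1'
    · have : (a : ℝ) < ((a' : ℝ) + 1) * n := by linarith
      exact_mod_cast this
  · rintro ⟨h1, h2⟩
    have h1' : ((a' : ℝ)) * n ≤ a := by exact_mod_cast h1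
    have h2' : (a : ℝ) + 1 ≤ ((a' : ℝ) + 1) * n := by
      have : a + 1 ≤ (a' + 1) * n := h2
      exact_mod_cast this
    constructor <;> nlinarith

/-- The number of fine cells in a coarse cell: `#{a : a′n ≤ a < (a′+1)n} = n`. [cite: MagnenRivasseauSeneor1993, §II.B p.335 tl.16–19] -/
theorem card_Ico_labels (n : ℕ) (a' : ℤ) : (Finset.Ico (a' * n) ((a' + 1) * n)).card = n := by
  rw [Int.card_Ico]
  have : (a' + 1) * (n : ℤ) - a' * n = n := by ring
  rw [this, Int.toNat_natCast]

/-- Every point of a coarse cell lies in the fine cell labelled `⌊x/t⌋`, and that label is admissible. [folklore] -/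
private theorem floor_label {t x : ℝ} (ht : 0 < t) (n : ℕ) (a' : ℤ)
    (hx : x ∈ Ico ((a' : ℝ) * (n * t)) (((a' : ℝ) + 1) * (n * t))) :
    x ∈ Ico ((⌊x / t⌋ : ℝ) * t) (((⌊x / t⌋ : ℝ) + 1) * t) ∧ a' * n ≤ ⌊x / t⌋ ∧ ⌊x / t⌋ < (a' + 1) * n := by
  have hfl : (⌊x / t⌋ : ℝ) ≤ x / t := Int.floor_le _
  have hlt : x / t < (⌊x / t⌋ : ℝ) + 1 := Int.lt_floor_add_one _
  rw [mem_Ico] at hx ⊢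
  refine ⟨⟨?_, ?_⟩, ?_, ?_⟩
  · rwa [← le_div_iff₀ ht]
  · rwa [← div_lt_iff₀ ht]
  · have h : ((a' : ℝ)) * n ≤ x / t := by rw [le_div_iff₀ ht]; nlinarith [hx.1]
    have : ((a' * n : ℤ) : ℝ) ≤ x / t := by push_cast; exact h
    exact Int.le_floor.2 this
  · have h : x / t < ((a' : ℝ) + 1) * n := by rw [div_lt_iff₀ ht]; nlinarith [hx.2]
    have h2 : (⌊x / t⌋ : ℝ) < ((a' : ℝ) + 1) * n := hfl.trans_lt h
    exact_mod_cast h2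

/-! ## §2 The lattices `𝐃_{i,α}` refine each other (`M` an integer): `𝐃_{i,α}` inside `𝐃_{i′,α′}` for `i′ ≤ i`, `α′ ≤ α` -/

variable {M : ℕ}

/-- The refinement ratio per direction between `𝐃_{i,α}` (fine) and `𝐃_{i′,α′}` (coarse): `M^{α−α′}` in the direction 0,
`M^{i−i′}` in the directions 1, 2, 3. [cite: MagnenRivasseauSeneor1993, §II.B p.335 tl.16–19; §VII p.375 tl.22–23, tl.38–39] -/
def ratio (M i i' : ℕ) (α α' : ℤ) (μ : Fin 4) : ℕ := if μ = 0 then M ^ (α - α').toNat else M ^ (i - i')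

/-- The coarse side is the ratio times the fine side: `M^{−α′} = M^{α−α′}·M^{−α}`, `M^{−i′} = M^{i−i′}·M^{−i}`.
[cite: MagnenRivasseauSeneor1993, §II.B p.335 tl.16–19] -/
theorem boxSide_coarse_eq (hM : 0 < M) {i i' : ℕ} (hi : i' ≤ i) {α α' : ℤ} (hα : α' ≤ α) (μ : Fin 4) :
    boxSide M i' α' μ = (ratio M i i' α α' μ : ℝ) * boxSide M i α μ := by
  have hM0 : (M : ℝ) ≠ 0 := by exact_mod_cast hM.ne'
  unfold boxSide ratio
  split_ifs with hμ
  · rw [Nat.cast_pow, ← zpow_natCast, Int.toNat_of_nonneg (sub_nonneg.2 hα), ← zpow_add₀ hM0]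
    congr 1; ring
  · rw [Nat.cast_pow, ← zpow_natCast, Nat.cast_sub hi, ← zpow_add₀ hM0]
    congr 1; ring

/-- **A box of `𝐃_{i,α}` lies in a box of `𝐃_{i′,α′}` iff its label does, direction by direction**: for `i′ ≤ i`, `α′ ≤ α` and
labels `k, k′ ∈ ℤ⁴` (lower corners in units of the sides), `Δ_k ⊆ Δ′_{k′}` iff `k′_μ r_μ ≤ k_μ < (k′_μ + 1) r_μ` for every `μ`,
`r = ratio`. [cite: MagnenRivasseauSeneor1993, §II.B p.335 tl.16–19] -/
theorem anisoBox_subset_iff (hM : 0 < M) {i i' : ℕ} (hi : i' ≤ i) {α α' : ℤ} (hα : α' ≤ α) (k k' : Fin 4 → ℤ) :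
    anisoBox (M : ℝ) i α k ⊆ anisoBox (M : ℝ) i' α' k'
      ↔ ∀ μ, k' μ * ratio M i i' α α' μ ≤ k μ ∧ k μ < (k' μ + 1) * ratio M i i' α α' μ := by
  have hMr : (0 : ℝ) < M := by exact_mod_cast hM
  have hne : (anisoBox (M : ℝ) i α k).Nonempty := by
    rw [anisoBox, univ_pi_nonempty_iff]
    intro μ
    exact nonempty_Ico.2 (by nlinarith [boxSide_pos hMr i α μ])
  rw [anisoBox, anisoBox, pi_subset_pi_iff]
  constructor
  · rintro (h | h)
    · intro μ
      have hμ := h μ (mem_univ μ)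
      rw [boxSide_coarse_eq hM hi hα μ] at hμ
      exact (Ico_subset_Ico_iff_labels (boxSide_pos hMr i α μ) _ _ _).1 hμ
    · exact absurd h hne.ne_empty
  · intro h
    left
    intro μ _
    rw [boxSide_coarse_eq hM hi hα μ]
    exact (Ico_subset_Ico_iff_labels (boxSide_pos hMr i α μ) _ _ _).2 (h μ)

/-- The labels of the boxes of `𝐃_{i,α}` contained in the box `Δ′_{k′}` of `𝐃_{i′,α′}`.
[cite: MagnenRivasseauSeneor1993, §II.B p.335 tl.16–19; §VII p.375 tl.22–23] -/
def fineLabels (M i i' : ℕ) (α α' : ℤ) (k' : Fin 4 → ℤ) : Finset (Fin 4 → ℤ) :=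
  Fintype.piFinset fun μ => Finset.Ico (k' μ * ratio M i i' α α' μ) ((k' μ + 1) * ratio M i i' α α' μ)

/-- Membership in `fineLabels` is containment of the boxes. [cite: MagnenRivasseauSeneor1993, §II.B p.335 tl.16–19] -/
theorem mem_fineLabels_iff (hM : 0 < M) {i i' : ℕ} (hi : i' ≤ i) {α α' : ℤ} (hα : α' ≤ α) (k k' : Fin 4 → ℤ) :
    k ∈ fineLabels M i i' α α' k' ↔ anisoBox (M : ℝ) i α k ⊆ anisoBox (M : ℝ) i' α' k' := by
  rw [anisoBox_subset_iff hM hi hα, fineLabels, Fintype.mem_piFinset]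
  simp only [Finset.mem_Ico]

/-- **The number of boxes of `𝐃_{i,α}` in a box of `𝐃_{i′,α′}` is `M^{α−α′}·M^{3(i−i′)}`.**
[cite: MagnenRivasseauSeneor1993, §II.B p.335 tl.16–19; §VII p.375 tl.22–23, tl.38–39] -/
theorem card_fineLabels (M i i' : ℕ) (α α' : ℤ) (k' : Fin 4 → ℤ) :
    (fineLabels M i i' α α' k').card = M ^ (α - α').toNat * (M ^ (i - i')) ^ 3 := by
  rw [fineLabels, Fintype.card_piFinset]
  simp only [card_Ico_labels, ratio, Fin.prod_univ_four]
  simp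
  ring

/-- **p.375 tl.22–23**: «the box of scale α′ (which contains `M^{α−α′}` boxes of scale α)» — same spatial index `i`, `α′ ≤ α`.
[cite: MagnenRivasseauSeneor1993, §VII p.375 tl.22–23] -/
theorem card_fineLabels_time (M i : ℕ) {α α' : ℕ} (k' : Fin 4 → ℤ) :
    (fineLabels M i i α α' k').card = M ^ (α - α') := by
  rw [card_fineLabels, Nat.sub_self, pow_zero, one_pow, mul_one]
  congr 1
  omega

/-- **p.375 tl.38–39**: «the `M^{4|i−i′|}` boxes of scale i contained in a box of scale i′» — isotropic boxes `α = i`, `α′ = i′`,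
`i′ ≤ i`. [cite: MagnenRivasseauSeneor1993, §VII p.375 tl.38–39] -/
theorem card_fineLabels_isotropic (M : ℕ) {i i' : ℕ} (hi : i' ≤ i) (k' : Fin 4 → ℤ) :
    (fineLabels M i i' i i' k').card = M ^ (4 * (i - i')) := by
  rw [card_fineLabels]
  have : ((i : ℤ) - (i' : ℤ)).toNat = i - i' := by
    rw [← Nat.cast_sub hi, Int.toNat_natCast]
  rw [this, ← pow_mul, ← pow_add]
  congr 1
  ring

/-! ## §3 Refinement: a box of `𝐃_{i′,α′}` is the disjoint union of the boxes of `𝐃_{i,α}` it contains -/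

/-- Every point of a box of `𝐃_{i′,α′}` lies in some box of `𝐃_{i,α}` contained in it (`i′ ≤ i`, `α′ ≤ α`): the one labelled by
the integer parts `⌊x_μ / side_μ⌋`. [cite: MagnenRivasseauSeneor1993, §II.B p.335 tl.16–19] -/
theorem exists_fine_box (hM : 0 < M) {i i' : ℕ} (hi : i' ≤ i) {α α' : ℤ} (hα : α' ≤ α) (k' : Fin 4 → ℤ)
    {x : Fin 4 → ℝ} (hx : x ∈ anisoBox (M : ℝ) i' α' k') :
    ∃ k ∈ fineLabels M i i' α α' k', x ∈ anisoBox (M : ℝ) i α k := by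
  have hMr : (0 : ℝ) < M := by exact_mod_cast hM
  rw [anisoBox, mem_univ_pi] at hx
  refine ⟨fun μ => ⌊x μ / boxSide M i α μ⌋, ?_, ?_⟩
  · rw [fineLabels, Fintype.mem_piFinset]
    intro μ
    have h := hx μ
    rw [boxSide_coarse_eq hM hi hα μ] at h
    have := floor_label (boxSide_pos hMr i α μ) _ _ h
    exact Finset.mem_Ico.2 ⟨this.2.1, this.2.2⟩
  · rw [anisoBox, mem_univ_pi]
    intro μ
    have h := hx μ
    rw [boxSide_coarse_eq hM hi hα μ] at h
    exact (floor_label (boxSide_pos hMr i α μ) _ _ h).1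

/-- **Refinement** («these boxes as refinements of a fixed lattice», p.335 tl.18–19): for `i′ ≤ i`, `α′ ≤ α` every box of
`𝐃_{i′,α′}` is the union of the `M^{α−α′}M^{3(i−i′)}` boxes of `𝐃_{i,α}` it contains. [cite: MagnenRivasseauSeneor1993, §II.B p.335 tl.16–19] -/
theorem biUnion_fine_boxes_eq (hM : 0 < M) {i i' : ℕ} (hi : i' ≤ i) {α α' : ℤ} (hα : α' ≤ α) (k' : Fin 4 → ℤ) :
    (⋃ k ∈ fineLabels M i i' α α' k', anisoBox (M : ℝ) i α k) = anisoBox (M : ℝ) i' α' k' := by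
  apply Subset.antisymm
  · intro x hx
    rw [mem_iUnion₂] at hx
    obtain ⟨k, hk, hxk⟩ := hx
    exact (mem_fineLabels_iff hM hi hα k k').1 hk hxk
  · intro x hx
    obtain ⟨k, hk, hxk⟩ := exists_fine_box hM hi hα k' hx
    exact mem_iUnion₂.2 ⟨k, hk, hxk⟩

/-- Two distinct boxes of one lattice `𝐃_{i,α}` are disjoint (half-open cells). [cite: MagnenRivasseauSeneor1993, §II.B p.335 tl.16–19] -/
theorem disjoint_anisoBox {Mr : ℝ} (hM : 0 < Mr) (i : ℕ) (α : ℤ) {k₁ k₂ : Fin 4 → ℤ} (hk : k₁ ≠ k₂) :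
    Disjoint (anisoBox Mr i α k₁) (anisoBox Mr i α k₂) := by
  obtain ⟨μ, hμ⟩ := Function.ne_iff.1 hk
  rw [Set.disjoint_left]
  intro x h1 h2
  rw [anisoBox, mem_univ_pi] at h1 h2
  have a1 := h1 μ; have a2 := h2 μ
  rw [mem_Ico] at a1 a2
  have hs := boxSide_pos hM i α μ
  rcases lt_or_gt_of_ne hμ with hlt | hlt
  · have : ((k₁ μ : ℝ)) + 1 ≤ k₂ μ := by exact_mod_cast hlt
    nlinarith [a1.2, a2.1]
  · have : ((k₂ μ : ℝ)) + 1 ≤ k₁ μ := by exact_mod_cast hlt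
    nlinarith [a1.1, a2.2]

/-! ## §4 The counts in the vertical resummations of Sect. VII (p.375), joined to the exponent arithmetic of
`…MRS93ConvergencePowerCounting` -/

/-- **p.375 tl.21–24** «any contribution of scale α attached to a box of scale α′, with α_min ≤ α′ < α can be resummed in the box of
scale α′ (which contains M^{α−α′} boxes of scale α) using one coupling constant λ ≤ M^{−(α−α′)}»: summing one coupling `λ` over the
boxes of `𝐃_{i,α}` inside a box of `𝐃_{i,α′}` costs at most `1` (the count `card_fineLabels_time` times
`Convergence.resum_alpha`). [cite: MagnenRivasseauSeneor1993, §VII p.375 tl.21–24] -/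
theorem sum_coupling_fineLabels_le_one (hM : 0 < M) (i : ℕ) {α α' : ℕ} (k' : Fin 4 → ℤ) {lam : ℝ}
    (hlam : lam ≤ ((M : ℝ) ^ (α - α'))⁻¹) :
    ∑ _k ∈ fineLabels M i i α α' k', lam ≤ 1 := by
  have hMr : (0 : ℝ) < M := by exact_mod_cast hM
  rw [Finset.sum_const, card_fineLabels_time, nsmul_eq_mul, Nat.cast_pow]
  exact Convergence.resum_alpha hMr α α' hlam

/-- **p.375 tl.33–36** «power counting provides the necessary factor M^{−5|i−i′|} to resum a box of scale i among the M^{4|i−i′|}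
boxes of scale i contained in a box of scale i′»: summing the factor `M^{−5(i−i′)}` over the boxes of `𝐃_{i,i}` inside a box of
`𝐃_{i′,i′}` (`i′ ≤ i`) leaves exactly `M^{−(i−i′)}` (the count `card_fineLabels_isotropic` times `Convergence.resum_vertical`),
summable over the scale difference by `Convergence.vertical_sum_converges`. [cite: MagnenRivasseauSeneor1993, §VII p.375 tl.33–36] -/
theorem sum_powerCounting_fineLabels_eq (hM : 0 < M) {i i' : ℕ} (hi : i' ≤ i) (k' : Fin 4 → ℤ) :
    ∑ _k ∈ fineLabels M i i' i i' k', (M : ℝ) ^ (-(5 * |(i : ℤ) - i'|)) = (M : ℝ) ^ (-|(i : ℤ) - i'|) := by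
  have hMr : (0 : ℝ) < M := by exact_mod_cast hM
  rw [Finset.sum_const, card_fineLabels_isotropic M hi, nsmul_eq_mul, Nat.cast_pow, ← Convergence.resum_vertical hMr]
  congr 1
  rw [abs_of_nonneg (by omega : (0 : ℤ) ≤ (i : ℤ) - i'), ← zpow_natCast]
  congr 1
  push_cast [Nat.cast_sub hi]
  ring

/-! ## §5 (Edition v1.1, add-only) «there is only one box which contains a box in the next lower frequency» and «there are M⁴ boxes
of the next higher frequency in a typical cubic box» (Sect. VII p.376 tl.29–31) -/

/-- `ratio ≥ 1` for `M ≥ 1` (so the integer divisions below are by positive numbers). [folklore] -/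
private theorem one_le_ratio (hM : 0 < M) (i i' : ℕ) (α α' : ℤ) (μ : Fin 4) : 1 ≤ ratio M i i' α α' μ := by
  unfold ratio; split_ifs <;> exact Nat.one_le_pow _ _ hM

/-- **Upward: every box of `𝐃_{i,α}` lies in exactly one box of `𝐃_{i′,α′}`** (`i′ ≤ i`, `α′ ≤ α`) — «there is only one box which
contains a box in the next lower frequency» (p.376 tl.31); its label is the integer quotient `k_μ / r_μ` direction by direction.
[cite: MagnenRivasseauSeneor1993, Sect. VII p.376 tl.29–31; §II.B p.335 tl.16–19] -/
theorem existsUnique_coarse_box (hM : 0 < M) {i i' : ℕ} (hi : i' ≤ i) {α α' : ℤ} (hα : α' ≤ α) (k : Fin 4 → ℤ) :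
    ∃! k' : Fin 4 → ℤ, anisoBox (M : ℝ) i α k ⊆ anisoBox (M : ℝ) i' α' k' := by
  have hr : ∀ μ, (0 : ℤ) < ratio M i i' α α' μ := fun μ => by exact_mod_cast one_le_ratio hM i i' α α' μ
  have hMr : (0 : ℝ) < M := by exact_mod_cast hM
  have hsub : anisoBox (M : ℝ) i α k ⊆ anisoBox (M : ℝ) i' α' (fun μ => k μ / (ratio M i i' α α' μ : ℤ)) := by
    rw [anisoBox_subset_iff hM hi hα]
    exact fun μ => ⟨Int.ediv_mul_le _ (hr μ).ne', Int.lt_ediv_add_one_mul_self _ (hr μ)⟩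
  refine ⟨_, hsub, fun k' hk' => ?_⟩
  by_contra hne
  have hne' : (anisoBox (M : ℝ) i α k).Nonempty := by
    rw [anisoBox, univ_pi_nonempty_iff]
    exact fun μ => nonempty_Ico.2 (by nlinarith [boxSide_pos hMr i α μ])
  obtain ⟨x, hx⟩ := hne'
  exact Set.disjoint_left.1 (disjoint_anisoBox hMr i' α' hne) (hk' hx) (hsub hx)

/-- **«there are M⁴ boxes of the next higher frequency in a typical cubic box»** (p.376 tl.29–30): a box of the isotropic lattice
`𝐃_{i,i}` contains exactly `M⁴` boxes of `𝐃_{i+1,i+1}`. [cite: MagnenRivasseauSeneor1993, Sect. VII p.376 tl.29–30] -/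
theorem card_fineLabels_next (M i : ℕ) (k' : Fin 4 → ℤ) : (fineLabels M (i + 1) i (i + 1) i k').card = M ^ 4 := by
  have h := card_fineLabels_isotropic M (Nat.le_succ i) k'
  simpa using h

/-! ## §6 (Edition v1.1, add-only) Proximity links: «All these links extend only to a bounded distance, independent of λ. It is possible to
resum over such links (which costs only a factor independent of λ)» (Sect. VII p.375 tl.45–47) -/

/-- The labels of the boxes of one lattice within label sup-distance `L` of the box `k` (a cube of side `2L+1` in `ℤ⁴`).
[cite: MagnenRivasseauSeneor1993, Sect. VII p.375 tl.44–47] -/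
def proximityLabels (k : Fin 4 → ℤ) (L : ℕ) : Finset (Fin 4 → ℤ) :=
  Fintype.piFinset fun μ => Finset.Icc (k μ - L) (k μ + L)

/-- Membership: `k′` is within label sup-distance `L` of `k` iff `|k_μ − k′_μ| ≤ L` in every direction.
[cite: MagnenRivasseauSeneor1993, Sect. VII p.375 tl.44–47] -/
theorem mem_proximityLabels_iff (k k' : Fin 4 → ℤ) (L : ℕ) :
    k' ∈ proximityLabels k L ↔ ∀ μ, |k μ - k' μ| ≤ L := by
  rw [proximityLabels, Fintype.mem_piFinset]
  refine forall_congr' fun μ => ?_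
  rw [Finset.mem_Icc, abs_sub_comm, abs_le]
  constructor
  · rintro ⟨h1, h2⟩; constructor <;> linarith
  · rintro ⟨h1, h2⟩; constructor <;> linarith

/-- **«which costs only a factor independent of λ»**: the number of boxes of one lattice within label sup-distance `L` of a given box
is `(2L+1)⁴` — a constant depending on the bounded link range `L` only (not on `λ`, `M`, `i`, `α`).
[cite: MagnenRivasseauSeneor1993, Sect. VII p.375 tl.44–47] -/
theorem card_proximityLabels (k : Fin 4 → ℤ) (L : ℕ) : (proximityLabels k L).card = (2 * L + 1) ^ 4 := by
  rw [proximityLabels, Fintype.card_piFinset]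
  have h : ∀ μ, (Finset.Icc (k μ - L) (k μ + L)).card = 2 * L + 1 := fun μ => by
    rw [Int.card_Icc]
    have : k μ + L + 1 - (k μ - L) = ((2 * L + 1 : ℕ) : ℤ) := by push_cast; ring
    rw [this, Int.toNat_natCast]
  simp only [h, Finset.prod_const, Finset.card_univ, Fintype.card_fin]

/-- Summing any weight bounded by `w₀ ≥ 0` over the proximity-linked boxes costs at most `(2L+1)⁴ · w₀`.
[cite: MagnenRivasseauSeneor1993, Sect. VII p.375 tl.44–47] -/
theorem sum_proximityLabels_le (k : Fin 4 → ℤ) (L : ℕ) {w : (Fin 4 → ℤ) → ℝ} {w₀ : ℝ} (hw : ∀ k', w k' ≤ w₀) :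
    ∑ k' ∈ proximityLabels k L, w k' ≤ (2 * L + 1) ^ 4 * w₀ := by
  refine (Finset.sum_le_sum fun k' _ => hw k').trans (le_of_eq ?_)
  rw [Finset.sum_const, card_proximityLabels, nsmul_eq_mul]
  push_cast
  ring

end NestedLattices

end Literature.MathematicalPhysics.QuantumFieldTheory.MagnenRivasseauSeneor1993
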